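import Mathlib.MeasureTheory.Integral.Average
import Mathlib.Analysis.Calculus.MeanValue
import Mathlib.Analysis.Complex.Basic
import Literature.Geometry.Lorentzian.BondiMass
import Literature.Geometry.Lorentzian.CauchyDevelopment
import HarnessLib

/-!
# Bondi–Sachs radiative ends of a Cauchy development: mass aspect, shear and news (hypothesis
# structure, tier L)

Definition request `defn-BondiSachsRadiativeEnd` (route FinalStateConjecture/AtomicSupermomentum;
gives Lean signatures to its items `SupermomentumAtomicity`, `ScriToBulkRadiationZone`,
`LateMassAspectSoft`). The requester's words: *"hypothesis structure, tier L, over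
`CauchyDevelopment D` for 3-dimensional data, in the style of `BondiMass.lean`'s `BondiFoliation`
but over the REPAIRED development structure and WITH the radiative fields: a retarded-time family
`u ↦ C_u` (`u ≥ u₀`) of outgoing null hypersurfaces of the development, each with sections
`S_{u,s}` receding to infinity, such that along each `C_u` the renormalised limits exist and are
recorded as fields: Bondi mass aspect `m : ℝ → C(S², ℝ)` (sphere average `⨍ m(u,·) = M_B(u)`),
asymptotic shear `σ : ℝ → C(S², ℂ)` and news `N := ∂_u σ̄`, satisfying as PROP fields the
Christodoulou–Klainerman Ch. 17 conclusions: (i) the mass-loss law […] (so `dM_B/du = −⨍|N|² ≤ 0`),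
(ii) `∫_{u₀}^∞ ∮ |N|² < ∞`, (iii) `0 ≤ M_B(u) ≤ E_ADM` may be recorded as in
`BondiFoliation.IsCanonical`. Plus definitions `HasFiniteMemory`, `HasLateMassAspect`,
`NewsDecays`."*

## What the sources print (the conclusions recorded as Prop fields)

Bondi–van der Burg–Metzner, Proc. R. Soc. A 269 (1962) 21, Part B §§3–5 and Sachs, Proc. R. Soc.
A 270 (1962) 103: in Bondi coordinates `(u, r, θ, φ)` near future null infinity the metric
functions have the expansions `γ = σ⁰(u,θ,φ)/r + O(r⁻³)`, `V = r − 2M(u,θ,φ) + O(r⁻¹)`; `M` is the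
**mass aspect**, `σ⁰` the **asymptotic shear**, `N = ∂_u σ̄⁰` (up to the conventional conjugation)
the **news**; the supplementary conditions give the **mass-loss formula** for the Bondi mass
`M_B(u) = (4π)⁻¹ ∮ M(u,·) dΩ`: `dM_B/du = −(4π)⁻¹ ∮ |∂_u σ⁰|² dΩ ≤ 0` ("the mass of a system is
constant if and only if there is no news", BvdBM §5); at the level of the aspect,
`∂_u M = −|∂_u σ⁰|² + (linear second angular derivatives of ∂_u σ̄⁰)`, the linear term integrating
to zero over the sphere. Christodoulou–Klainerman 1993, Ch. 17, conclusions 17.0.1–17.0.9 prove,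
for vacuum developments of strongly asymptotically flat data: the Hawking masses of the sections
of the outgoing cones `C_u⁺` converge to the Bondi mass (17.0.3); the Bondi mass-loss formula
`∂_u M = −(32π)⁻¹ ∫_{S²} |Ξ|²` with the news tensor `Ξ = 2 lim r χ̲̂_u` (17.0.8, their
normalisation); `∫∫ |Ξ|² du dΩ < ∞` and `M(u) → M(+∞)` (17.0.9); `0 ≤ M ≤ E_ADM`. Wald 1984,
§11.2, (11.2.13) ff. (Bondi energy flux `= −(news)²`).

## Rendering and faithfulness

* The geometric half is `BondiFoliation` (file `BondiMass.lean`) VERBATIM, re-based on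
  `CauchyDevelopment D` (the corrected development structure of `CauchyDevelopment.lean`; the old
  `Development` has a defective Cauchy-surface field): a surface type `surf` (compact Hausdorff
  smooth 2-manifold with its Borel structure — meant `S²`), an antitone exhausting family of
  compact pieces `B u` of the data, sections `sec u s : surf → M` of the outgoing cones
  `C_u⁺ = ∂J⁺(ι(B u))` which are compact spacelike embedded surfaces with null normal pairs whose
  outgoing leg is tangent to the cone generators, receding to infinity (areas `→ ∞`), restricted
  to retarded times `u ≥ u₀`.
* The radiative half: a finite reference ("unit round sphere") measure `μ` on `surf` of total mass
  `4π`, against which the printed sphere integrals `∮ · dΩ` are taken; the fields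
  `massAspect u : surf → ℝ`, `shear u : surf → ℂ`, `news u : surf → ℂ`, continuous on `surf`, with
  `news u y = d/du conj (shear u y)` (`HasDerivAt`, BvdBM's `N = ∂_u σ̄⁰`); the TIE to the geometry
  — the normalisation the requester allows ("any standard normalisation with sphere average
  `⨍ m(u,·) = M_B(u)`") — is the field `hasBondiMass`: the Hawking masses of the sections of `C_u⁺`
  converge to `⨍ massAspect u dμ` (CK 17.0.3); the LAWS: `massLoss` — `u ↦ ⨍ m(u,·) dμ` has
  derivative `−⨍ |N(u,·)|² dμ` at every `u ≥ u₀` (BvdBM (35)/§5, Wald (11.2.13): the printed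
  `dM_B/du = −(4π)⁻¹∮|∂_uσ⁰|²`), and `newsFlux_integrableOn` — `u ↦ ∮ |N(u,·)|² dμ` is integrable on
  `[u₀, ∞)` (CK 17.0.9, (ii) of the request).
* NOT encoded, deliberately (scope): the ASPECT-LEVEL weak law (i) with its linear term
  `(ð̄² N̄ + c.c.)/4` — the tree has no edth operator / spin-weighted harmonics on `surf`, and a free
  "linear term" field would carry no content; only its sphere average (the exact Bondi mass loss)
  is recorded, which is what `dM_B/du = −⨍|N|²` needs. The identification of `shear` with the
  renormalised limit `lim r χ̂` of the null second fundamental forms of the sections (no asymptotic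
  frames on `surf`); (iii) `0 ≤ M_B ≤ E_ADM` is the separate Prop structure `IsCanonical`, exactly
  as in `BondiFoliation.IsCanonical`. BMS (supertranslation / boost) transformation rules relate
  TWO radiative ends of the same development through a construction of one from the other and
  cannot be lemmas about a hypothesis structure; they are not stated. Nothing here is asserted to
  EXIST: the structure is consumed as `∀ 𝓔 : BondiSachsRadiativeEnd 𝒟, …`.
* PROVED from the fields: the Bondi mass `bondiMass 𝓔 u := ⨍ massAspect u dμ` is non-increasing
  on `[u₀, ∞)` (`bondiMass_antitoneOn`, from `massLoss`), agrees with the limit of the Hawking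
  masses (`tendsto_sectionHawkingMass`), and for a canonical end converges as `u → ∞` to a final Bondi
  mass in `[0, E_ADM]`.

## References

* H. Bondi, M. G. J. van der Burg, A. W. K. Metzner, *Gravitational waves in general relativity
  VII*, Proc. R. Soc. A 269 (1962) 21–52, Part B §§3–5 (mass aspect, news, mass loss).
* R. K. Sachs, *Gravitational waves in general relativity VIII*, Proc. R. Soc. A 270 (1962) 103.
* D. Christodoulou, S. Klainerman, *The global nonlinear stability of the Minkowski space* (1993),
  Ch. 17, conclusions 17.0.1–17.0.9. [ChristodoulouKlainerman1993]
* R. M. Wald, *General Relativity* (1984), §11.2, (11.2.13) ff. [Wald1984]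
* T. Mädler, J. Winicour, *Bondi–Sachs formalism*, Scholarpedia 11 (2016), arXiv:1609.01731, §§3–4.
-/

noncomputable section

open Bundle Set Manifold TopologicalSpace Filter MeasureTheory Real
open scoped ContDiff Topology ENNReal ComplexConjugate

universe u

namespace Literature.Geometry.Lorentzian

variable {X : Type u} [TopologicalSpace X] [ChartedSpace (EuclideanSpace ℝ (Fin 3)) X]
  [IsManifold (𝓡 3) ∞ X] [ConnectedSpace X] {D : InitialDataSet (𝓡 3) X}

/-- Hypothesis structure: a **Bondi–Sachs radiative end** of the Cauchy development
`𝒟 = (M, g, τ, ι, ν)` of the `3`-dimensional initial data set `D`. GEOMETRY (as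
`BondiFoliation`, over `CauchyDevelopment`): a surface type `surf` (meant `S²`), an antitone
exhausting family of compact pieces `B u ⊆ X`, and for every retarded time `u` sections
`sec u s : surf → M` (`s ∈ ℝ`) of the outgoing null cone `C_u⁺ = ∂J⁺(ι(B u))`, compact spacelike
embedded surfaces with null normal pairs `(L, L̲)`, `L` tangent to the cone generators, receding
to infinity. RADIATIVE FIELDS on `surf`, for `u ≥ u₀`: a reference sphere measure `μ` of mass `4π`,
the mass aspect `m(u,·)`, asymptotic shear `σ(u,·)` and news `N(u,·) = ∂_u σ̄(u,·)`, continuous in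
the angles, normalised by `⨍ m(u,·) dμ = lim_s m_H(S_{u,s})` (CK 17.0.3), with the Bondi
mass-loss law `d/du ⨍ m(u,·) dμ = −⨍ |N(u,·)|² dμ` (BvdBM §5; CK 17.0.8; Wald (11.2.13)) and finite
total news flux `∫_{u₀}^∞ ∮ |N|² dμ du < ∞` (CK 17.0.9). Not encoded: the aspect-level law with
its angular term, the shear as a geometric limit, BMS covariance (module docstring). No existence
is asserted. [cite: ChristodoulouKlainerman1993, Ch. 17, conclusions 17.0.1–17.0.9]
[cite: Wald1984, §11.2 (11.2.13)] -/
structure BondiSachsRadiativeEnd (𝒟 : CauchyDevelopment D) where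
  /-- The surface type of the sections and of the sphere at infinity (meant `S²`). -/
  surf : Type
  /-- Topology of the surface type. -/
  [top : TopologicalSpace surf]
  /-- The surface type is a `2`-manifold. -/
  [charted : ChartedSpace (EuclideanSpace ℝ (Fin 2)) surf]
  /-- The surface type is a smooth manifold. -/
  [mfd : IsManifold (𝓡 2) ∞ surf]
  /-- The surface type is compact. -/
  [compact : CompactSpace surf]
  /-- The surface type is Hausdorff. -/
  [t2 : T2Space surf]
  /-- Measurable structure of the surface type. -/
  [meas : MeasurableSpace surf]
  /-- The measurable structure is the Borel one. -/
  [borel : BorelSpace surf]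
  /-- Standing hypothesis: `g` has its Levi-Civita connection (as in `BondiFoliation`). -/
  [hasLeviCivita : 𝒟.metric.toPseudoRiemannianMetric.HasLeviCivita]
  /-- The smoothness fact for pullbacks of metrics along maps `surf → M` (as in `BondiFoliation`). -/
  hpb : PseudoRiemannianMetric.contMDiff_pullbackBilin (𝓡 (3 + 1)) 𝒟.carrier (𝓡 2) surf ∞
  /-- The initial retarded time: the radiative fields are recorded for `u ≥ u₀`. -/
  u₀ : ℝ
  /-- The compact pieces `B u ⊆ X` of the data, labelled by retarded time `u`. -/
  B : ℝ → Set X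
  /-- Each `B u` is compact. -/
  isCompact_B (u : ℝ) : IsCompact (B u)
  /-- Later retarded times correspond to smaller pieces of the data. -/
  antitone_B : Antitone B
  /-- The pieces exhaust the data manifold (as `u → -∞`). -/
  iUnion_B : ⋃ u, B u = univ
  /-- The sections `S_{u,s} = sec u s : surf → M` of the outgoing cones. -/
  sec : ℝ → ℝ → surf → 𝒟.carrier
  /-- The section `S_{u,s}` lies on the outgoing cone `C_u⁺ = ∂J⁺(ι (B u))`. -/
  range_sec_subset (u s : ℝ) :
    range (sec u s) ⊆ 𝒟.metric.futureNullConeBoundary 𝒟.timeOrientation 𝒟.embed (B u)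
  /-- Each section is a smooth embedding. -/
  isSmoothEmbedding (u s : ℝ) : Manifold.IsSmoothEmbedding (𝓡 2) (𝓡 (3 + 1)) ∞ (sec u s)
  /-- Each section is a spacelike immersion. -/
  isSpacelike (u s : ℝ) : 𝒟.metric.IsSpacelikeImmersion (𝓡 2) (sec u s)
  /-- The null normal pair `(L, L̲)` of each section, `L` outgoing. -/
  pair (u s : ℝ) : LorentzianMetric.NullNormalPair (𝓡 2) 𝒟.metric 𝒟.timeOrientation (sec u s)
  /-- `L` is tangent to the null geodesic generators of the cone `C_u⁺`: the geodesic through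
  `sec u s y` with velocity `L y` lies in `C_u⁺` for small positive affine parameter. -/
  tangent_L (u s : ℝ) (y : surf) :
    ∃ (γ : ℝ → 𝒟.carrier) (ε : ℝ), 0 < ε ∧
      IsGeodesicOn 𝒟.metric.leviCivita γ (Ioo (-ε) ε) ∧ γ 0 = sec u s y ∧
      velocity (𝓡 (3 + 1)) γ 0 = (pair u s).L y ∧
      ∀ t ∈ Ioo 0 ε, γ t ∈ 𝒟.metric.futureNullConeBoundary 𝒟.timeOrientation 𝒟.embed (B u)
  /-- The sections recede to infinity along each cone: their areas tend to `∞` as `s → ∞`. -/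
  tendsto_area (u : ℝ) :
    Tendsto
      (fun s ↦ totalArea (𝒟.metric.inducedRiemannianMetric (sec u s) hpb (isSpacelike u s)))
      atTop (𝓝 ⊤)
  /-- The reference ("unit round sphere") measure on `surf`, against which `∮ · dΩ` is taken. -/
  μ : Measure surf
  /-- `μ` is a finite measure … -/
  [isFiniteMeasure : IsFiniteMeasure μ]
  /-- … of total mass `4π` (the area of the unit round sphere). -/
  measure_univ : μ univ = ENNReal.ofReal (4 * π)
  /-- The **Bondi mass aspect** `m(u, ·)` (BvdBM's `M(u, θ, φ)`; CK's Hawking-mass density limit). -/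
  massAspect : ℝ → surf → ℝ
  /-- `m(u, ·)` is continuous in the angles. -/
  continuous_massAspect (u : ℝ) : Continuous (massAspect u)
  /-- The **asymptotic shear** `σ(u, ·)` (BvdBM's `σ⁰`). -/
  shear : ℝ → surf → ℂ
  /-- `σ(u, ·)` is continuous in the angles. -/
  continuous_shear (u : ℝ) : Continuous (shear u)
  /-- The **news** `N(u, ·)`. -/
  news : ℝ → surf → ℂ
  /-- `N(u, ·)` is continuous in the angles. -/
  continuous_news (u : ℝ) : Continuous (news u)
  /-- `N = ∂_u σ̄`: at every `u ≥ u₀` and every angle, `u ↦ conj (σ(u, y))` has derivative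
  `N(u, y)` (BvdBM §4). -/
  hasDerivAt_conj_shear (u : ℝ) (hu : u₀ ≤ u) (y : surf) :
    HasDerivAt (fun v ↦ conj (shear v y)) (news u y) u
  /-- NORMALISATION / tie to the geometry (CK 17.0.3): along every cone `C_u⁺`, `u ≥ u₀`, the
  Hawking masses of the sections converge to the sphere average of the mass aspect,
  `m_H(S_{u,s}) → ⨍ m(u, ·) dμ = M_B(u)` as `s → ∞`. -/
  hasBondiMass (u : ℝ) (hu : u₀ ≤ u) :
    Tendsto (fun s ↦ 𝒟.metric.hawkingMass (sec u s) hpb (isSpacelike u s) (pair u s)) atTop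
      (𝓝 (⨍ y, massAspect u y ∂μ))
  /-- **Bondi mass loss** (BvdBM §5; CK 17.0.8; Wald (11.2.13)): for `u ≥ u₀`,
  `d/du ⨍ m(u, ·) dμ = −⨍ |N(u, ·)|² dμ`. -/
  massLoss (u : ℝ) (hu : u₀ ≤ u) :
    HasDerivAt (fun v ↦ ⨍ y, massAspect v y ∂μ) (-⨍ y, ‖news u y‖ ^ 2 ∂μ) u
  /-- Finite total news flux (CK 17.0.9): `u ↦ ∮ |N(u, ·)|² dμ` is integrable on `[u₀, ∞)`. -/
  newsFlux_integrableOn : IntegrableOn (fun u ↦ ∫ y, ‖news u y‖ ^ 2 ∂μ) (Ici u₀)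

namespace BondiSachsRadiativeEnd

attribute [instance] top charted mfd compact t2 meas borel isFiniteMeasure

variable {𝒟 : CauchyDevelopment D} (𝓔 : BondiSachsRadiativeEnd 𝒟)

/-! ### The Bondi mass and the requested late-time predicates -/

/-- The Hawking mass `m_H(S_{u,s})` of the section `S_{u,s}` (w.r.t. its null normal pair, the
bundled smoothness fact `hpb` and Levi-Civita hypothesis), as in `BondiFoliation.sectionHawkingMass`.
[cite: ChristodoulouKlainerman1993, Ch. 17] -/
def sectionHawkingMass (u s : ℝ) : ℝ :=
  haveI := 𝓔.hasLeviCivita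
  𝒟.metric.hawkingMass (𝓔.sec u s) 𝓔.hpb (𝓔.isSpacelike u s) (𝓔.pair u s)

/-- The **Bondi mass** `M_B(u) = ⨍ m(u, ·) dμ = (4π)⁻¹ ∮ M dΩ` of the radiative end at retarded
time `u` (BvdBM §5; by `hasBondiMass` it is the limit of the Hawking masses of the sections of
`C_u⁺`, CK 17.0.3). [cite: ChristodoulouKlainerman1993, Ch. 17, conclusion 17.0.3] -/
def bondiMass (u : ℝ) : ℝ :=
  ⨍ y, 𝓔.massAspect u y ∂𝓔.μ

/-- The **news flux** `F(u) = ∮ |N(u, ·)|² dμ` through the sphere at retarded time `u`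
(`dM_B/du = −F/4π`). [cite: Wald1984, §11.2 (11.2.13)] -/
def newsFlux (u : ℝ) : ℝ :=
  ∫ y, ‖𝓔.news u y‖ ^ 2 ∂𝓔.μ

/-- The radiative end **has finite memory**: the asymptotic shear has a limit `σ(u, ·) → σinf` in
`L¹(S², dμ)` as `u → +∞` (the displacement memory is then `σinf − σ(u₀, ·)`).
[cite: ChristodoulouKlainerman1993, Ch. 17, conclusion 17.0.9] -/
def HasFiniteMemory (𝓔 : BondiSachsRadiativeEnd 𝒟) : Prop :=
  ∃ σinf : 𝓔.surf → ℂ, Integrable σinf 𝓔.μ ∧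
    Tendsto (fun u ↦ ∫ y, ‖𝓔.shear u y - σinf y‖ ∂𝓔.μ) atTop (𝓝 0)

/-- The radiative end **has late mass aspect `minf`** (a distribution on the sphere, given by its
values on smooth test functions `ψ : surf → ℝ`): `∫ m(u, ·) ψ dμ → minf ψ` as `u → +∞` for every
smooth `ψ`. [cite: ChristodoulouKlainerman1993, Ch. 17, conclusion 17.0.9] -/
def HasLateMassAspect (minf : (𝓔.surf → ℝ) → ℝ) : Prop :=
  ∀ ψ : 𝓔.surf → ℝ, ContMDiff (𝓡 2) 𝓘(ℝ, ℝ) ∞ ψ →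
    Tendsto (fun u ↦ ∫ y, 𝓔.massAspect u y * ψ y ∂𝓔.μ) atTop (𝓝 (minf ψ))

/-- **The news decays**: `N(u, ·) → 0` uniformly on the sphere as `u → +∞`.
[cite: ChristodoulouKlainerman1993, Ch. 17, conclusion 17.0.9] -/
def NewsDecays (𝓔 : BondiSachsRadiativeEnd 𝒟) : Prop :=
  TendstoUniformly 𝓔.news 0 atTop

/-- The radiative end **has final Bondi mass `m`**: `M_B(u) → m` as `u → +∞` (CK 17.0.9).
[cite: ChristodoulouKlainerman1993, Ch. 17, conclusion 17.0.9] -/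
def HasFinalBondiMass (m : ℝ) : Prop :=
  Tendsto 𝓔.bondiMass atTop (𝓝 m)

/-- Prop structure: the radiative end is **canonical** for the asymptotically flat end `e` of the
data — the two printed inequalities not implied by the fields: positivity of the Bondi mass
(Schoen–Yau 1982; Horowitz–Perry; Ludvigsen–Vickers) and the bound by the ADM energy
(CK 17.0.8–17.0.9), for `u ≥ u₀`; cf. `BondiFoliation.IsCanonical`.
[cite: ChristodoulouKlainerman1993, Ch. 17, conclusions 17.0.8–17.0.9] [cite: SchoenYau1982] -/
structure IsCanonical (e : AFEnd X) : Prop where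
  /-- Positivity of the Bondi mass. -/
  bondiMass_nonneg (u : ℝ) (hu : 𝓔.u₀ ≤ u) : 0 ≤ 𝓔.bondiMass u
  /-- The Bondi mass is bounded by the ADM energy of the end `e`. -/
  bondiMass_le_admEnergy (u : ℝ) (hu : 𝓔.u₀ ≤ u) : 𝓔.bondiMass u ≤ AFEnd.admEnergy e D

/-! ### Consequences of the fields -/

variable {𝓔}

/-- The Hawking masses of the sections of `C_u⁺` converge to the Bondi mass `M_B(u)` (field
`hasBondiMass`, restated). [cite: ChristodoulouKlainerman1993, Ch. 17, conclusion 17.0.3] -/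
theorem tendsto_sectionHawkingMass {u : ℝ} (hu : 𝓔.u₀ ≤ u) :
    Tendsto (𝓔.sectionHawkingMass u) atTop (𝓝 (𝓔.bondiMass u)) :=
  𝓔.hasBondiMass u hu

/-- The mass-loss law in terms of `bondiMass` and `newsFlux`: `dM_B/du = −⨍ |N|² dμ`.
[cite: Wald1984, §11.2 (11.2.13)] -/
theorem hasDerivAt_bondiMass {u : ℝ} (hu : 𝓔.u₀ ≤ u) :
    HasDerivAt 𝓔.bondiMass (-⨍ y, ‖𝓔.news u y‖ ^ 2 ∂𝓔.μ) u :=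
  𝓔.massLoss u hu

/-- The news flux is nonnegative. [folklore] -/
theorem newsFlux_nonneg (u : ℝ) : 0 ≤ 𝓔.newsFlux u :=
  integral_nonneg fun _ ↦ by positivity

/-- The averaged news flux is nonnegative. [folklore] -/
theorem average_news_sq_nonneg (u : ℝ) : 0 ≤ ⨍ y, ‖𝓔.news u y‖ ^ 2 ∂𝓔.μ := by
  rw [average_eq]
  exact smul_nonneg (by positivity) (integral_nonneg fun _ ↦ by positivity)

/-- **Bondi mass loss** ("the mass of a system is constant if and only if there is no news",
BvdBM §5; CK 17.0.8): the Bondi mass is a non-increasing function of retarded time on `[u₀, ∞)`.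
PROVED from the field `massLoss` (a function with non-positive derivative is antitone).
[cite: ChristodoulouKlainerman1993, Ch. 17, conclusion 17.0.8] -/
theorem bondiMass_antitoneOn : AntitoneOn 𝓔.bondiMass (Ici 𝓔.u₀) := by
  have hd : ∀ u ∈ Ici 𝓔.u₀, HasDerivAt 𝓔.bondiMass (-⨍ y, ‖𝓔.news u y‖ ^ 2 ∂𝓔.μ) u :=
    fun u hu ↦ hasDerivAt_bondiMass hu
  refine antitoneOn_of_deriv_nonpos (convex_Ici _) ?_ ?_ ?_
  · exact fun u hu ↦ (hd u hu).continuousAt.continuousWithinAt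
  · rw [interior_Ici]
    exact fun u hu ↦ (hd u (Set.mem_Ici.2 (le_of_lt hu))).differentiableAt.differentiableWithinAt
  · rw [interior_Ici]
    intro u hu
    rw [(hd u (Set.mem_Ici.2 (le_of_lt hu))).deriv]
    exact neg_nonpos.2 (average_news_sq_nonneg u)

/-- Hence `M_B(u) ≤ M_B(u₀)` for every `u ≥ u₀`: the energy radiated up to time `u` is
`M_B(u₀) − M_B(u) ≥ 0`. [cite: ChristodoulouKlainerman1993, Ch. 17, conclusion 17.0.8] -/
theorem bondiMass_le_bondiMass_u₀ {u : ℝ} (hu : 𝓔.u₀ ≤ u) : 𝓔.bondiMass u ≤ 𝓔.bondiMass 𝓔.u₀ :=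
  bondiMass_antitoneOn Set.self_mem_Ici (Set.mem_Ici.2 hu) hu

/-- For a canonical radiative end the Bondi mass converges as `u → +∞` — to the final Bondi mass
`inf_{u ≥ u₀} M_B(u)` (a non-increasing function bounded below converges; CK 17.0.9).
[cite: ChristodoulouKlainerman1993, Ch. 17, conclusion 17.0.9] -/
theorem IsCanonical.hasFinalBondiMass {e : AFEnd X} (hc : 𝓔.IsCanonical e) :
    𝓔.HasFinalBondiMass (⨅ u : Ici 𝓔.u₀, 𝓔.bondiMass u) := by
  have hbdd : BddBelow (range fun u : Ici 𝓔.u₀ ↦ 𝓔.bondiMass u) :=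
    ⟨0, by rintro _ ⟨u, rfl⟩; exact hc.bondiMass_nonneg u u.2⟩
  have hanti : Antitone fun u : Ici 𝓔.u₀ ↦ 𝓔.bondiMass u :=
    fun a b hab ↦ bondiMass_antitoneOn a.2 b.2 hab
  have h := tendsto_atTop_ciInf hanti hbdd
  rw [HasFinalBondiMass, ← Filter.tendsto_comp_val_Ici_atTop (a := 𝓔.u₀)]
  exact h

/-- For a canonical radiative end the final Bondi mass lies in `[0, E_ADM]`.
[cite: ChristodoulouKlainerman1993, Ch. 17, conclusion 17.0.9] -/
theorem IsCanonical.finalBondiMass_mem_Icc {e : AFEnd X} (hc : 𝓔.IsCanonical e) :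
    (⨅ u : Ici 𝓔.u₀, 𝓔.bondiMass u) ∈ Icc 0 (AFEnd.admEnergy e D) := by
  haveI : Nonempty (Ici 𝓔.u₀) := ⟨⟨𝓔.u₀, Set.self_mem_Ici⟩⟩
  refine ⟨le_ciInf fun u ↦ hc.bondiMass_nonneg u u.2, ?_⟩
  exact (ciInf_le ⟨0, by rintro _ ⟨u, rfl⟩; exact hc.bondiMass_nonneg u u.2⟩ ⟨𝓔.u₀, Set.self_mem_Ici⟩).trans
    (hc.bondiMass_le_admEnergy _ le_rfl)

/-- If the news decays then the news flux tends to `0`, hence so does `dM_B/du` (the end becomes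
non-radiative). [folklore] -/
theorem NewsDecays.tendsto_newsFlux (h : 𝓔.NewsDecays) : Tendsto 𝓔.newsFlux atTop (𝓝 0) := by
  rw [Metric.tendsto_atTop]
  intro ε hε
  -- uniform smallness of `N`: `‖N(u, y)‖ < δ` for `u ≥ U`, all `y`
  set δ : ℝ := Real.sqrt (ε / (2 * (4 * π))) with hδ
  have hδpos : 0 < δ := Real.sqrt_pos.2 (by positivity)
  obtain ⟨U, hU⟩ := Filter.eventually_atTop.1 (Metric.tendstoUniformly_iff.1 h δ hδpos)
  refine ⟨U, fun u hu ↦ ?_⟩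
  have hbound : ∀ y, ‖𝓔.news u y‖ ^ 2 ≤ δ ^ 2 := fun y ↦ by
    have := hU u hu y
    rw [Pi.zero_apply, dist_zero_left] at this
    exact pow_le_pow_left₀ (norm_nonneg _) this.le 2
  have hint : 𝓔.newsFlux u ≤ δ ^ 2 * (4 * π) := by
    calc 𝓔.newsFlux u ≤ ∫ _, δ ^ 2 ∂𝓔.μ :=
          integral_mono_of_nonneg (Eventually.of_forall fun _ ↦ by positivity)
            (integrable_const _) (Eventually.of_forall hbound)
      _ = δ ^ 2 * (4 * π) := by
          rw [integral_const, smul_eq_mul, Measure.real, 𝓔.measure_univ,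
            ENNReal.toReal_ofReal (by positivity), mul_comm]
  rw [dist_zero_right, Real.norm_of_nonneg (newsFlux_nonneg u)]
  calc 𝓔.newsFlux u ≤ δ ^ 2 * (4 * π) := hint
    _ = ε / 2 := by
        rw [hδ, Real.sq_sqrt (by positivity)]
        field_simp
    _ < ε := half_lt_self hε

end BondiSachsRadiativeEnd

end Literature.Geometry.Lorentzian

end
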